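import Literature.MathematicalPhysics.QuantumFieldTheory.Balaban1983to89.Setup
import Literature.MathematicalPhysics.QuantumFieldTheory.Balaban1983to89.B8CurlGradHolonomy
import Literature.MathematicalPhysics.QuantumFieldTheory.Balaban1983to89.Beta.BackgroundVertices

/-!
# `Balaban1983to89.B12RegularSpaces111` — T. Bałaban, *Renormalization group approach to lattice gauge field
theories. I*, Commun. Math. Phys. **109** (1987) 249–301 [Balaban1987RG1]: the complex regular spaces
`U^c_j(X, α₀, α₁, γ₀)` of §1 pp. 262–263 — the gauge action (1.10) on pairs `(𝐔, 𝐉)`, the four conditions (i)–(iv)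
(1.11)–(1.16) as SEPARATE CONCRETE membership predicates, the space as the union of orbits, the convention `γ₀ = α₀`,
and the space (3.16) p. 273; gauge invariance «by the definition» PROVED (monotonicity and the `Setup.CplxRegularSpace`
instance: sibling file `B12RegularSpaces111Mono`)

HONEST FRAMING (cell `lit-balaban`, verbatim): statement-level skeleton of published theorems with citation tags; proofs where landed; nothing here is a claim about the Yang–Mills mass gap.

PDF held: `paper:balaban1987-cmp109-rg-i-small-field` (journal page = PDF page + 248); read from the page renders
`b2b-balaban-ref1/pages/1987-cmp109-rg-I-small-field/…-p014-x2.png` (p. 262), `…-p015-x2.png` (p. 263), `…-p025-x2.png`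
(p. 273), as images.

WHAT IS REPRODUCED.  SKELETON rows `B12.Eq1.10` (the action (1.10)), `B12.Eq1.11-1.14` (conditions (i)–(iii)),
`B12.Eq1.15-1.16` (condition (iv)), `B12.Txt@263` (`γ₀ = α₀`), `B12.Eq3.15-3.16` (member (3.16): the space; (3.15) is
`B12CauchyRemainder354.deriv_eq_circleIntegral_315`, row `B12.Eq3.15`) — until now carried ONLY by the abstract family of sets
`Setup.CplxRegularSpace` (*«Conditions (i)–(iv) themselves are reader-owned»*, DIVERGENCE F8; DEFINITIONS steward r20, gap A2:
*«a faithful typing needs the four conditions (i)–(iv) … as separate predicates on a carrier refining `Setup.CplxRegularSpace`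
(which has only the total `mem`)»*).

THE PRINT, verbatim.  p. 262: *«Now we define spaces of configurations 𝐔, 𝐉. We define them for each j, and we are interested
in local spaces determined by localization domains X ∈ 𝐃_j. The gauge field configuration 𝐔 is defined at bonds of X and has
values in Gᶜ, the configuration 𝐉 is also defined at bonds of X and has values in 𝔤ᶜ. A Gᶜ-valued gauge transformation u acts
on pairs (𝐔, 𝐉) in the following way  (𝐔, 𝐉)^u = (𝐔^u, R(u)𝐉) = (u₋𝐔u₊⁻¹, R(u₋)𝐉), (1.10)  where for a bond b = ⟨b₋, b₊⟩ we
define u_±(b) = u(b_±). The orbit of the group of Gᶜ-valued gauge transformations determined by a pair (𝐔, 𝐉) is denoted by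
[(𝐔, 𝐉)]. … The space U^c_j(X, α₀, α₁, γ₀) is a union of orbits [(𝐔, 𝐉)] determined by configurations 𝐔, 𝐉 satisfying
the four conditions written below.  (i) 𝐔 = U′U, U has values in the group G,  |∂U − 1| < α₀ξ² on X, (1.11)  for each cube
□ ⊂ X of a size O(1)LM there exists a G-valued gauge transformation u defined on □ and such, that U^u = exp iξA,
|A|, |∇^ξA| < O(1)LMBα₀ on □, (1.12)  with a sufficiently large constant B (it will be determined later).  (ii) U′ = exp iξA′,
A′ has values in the algebra 𝔤ᶜ,  |A′|, |∇^ξ_U A′| < α₁ on X. (1.13)  (iii) The configurations 𝐔, 𝐉 satisfy the bounds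
|∂𝐔 − 1| < α₀ξ², |𝐉| < γ₀ on X. (1.14)  (iv) We consider X as Ω₀, and we construct the sequence {Ω_n}, n = 1, …, j, of
maximal possible domains satisfying the conditions (1.3)–(1.6) [14] (with j, ξ instead of k, η, R = R₁). For this sequence,
or rather for its subsequences {Ω₀, Ω₁, …, Ω_n}, n = 1, …, j, we construct the functions U_n(V) in the axial gauges, for
regular Gᶜ-valued configurations V. We consider the pair  (U_n(M˙(𝐔)), J_n(M˙(𝐔))), n = 1, …, j, (1.15)  where
M˙(𝐔, b) = M^p(𝐔, b) = Ū^p(b) for b ∈ Λ_p (see (1.5) [14]), and J_n(M˙(𝐔)) is defined by the formula (1.8) with U_n(M˙(𝐔))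
instead of U_j, L⁻ⁿ instead of ξ. This pair satisfies the bounds.  |∂U_n(M˙(𝐔)) − 1| < α₀ξ², |J_n(M˙(𝐔))| < α₀(Lⁿξ)²
on X̃⁻², (1.16)  and the same bounds hold for U instead of 𝐔.  The domain X̃⁻² is obtained from X by taking away two layers of
cubes from π_j, which are closest to the boundary of X.»*  p. 263: *«Usually we consider spaces with γ₀ = α₀, and then we omit the
constant γ₀ from the symbol denoting the space. … Let us take the space of configurations (𝐔, 𝐉) satisfying the conditions
(i)–(iii) with constants α₀′, α₁′ instead of α₀, α₁. We assume that the constants α₀′, α₁′ are smaller than α₀, α₁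
correspondingly, then obviously these three conditions are satisfied in the original formulation. … The spaces U^c_j(X, α₀, α₁)
are, by the definition, gauge invariant also.»*  p. 273: *«Thus we have constructed the analytic extension (3.15) of the function
(3.7), defined on the space  U^c_j(X, ½α₀, ½α₁, α₀) ∩ {(𝐔, 𝐉): 𝐔, 𝐉 satisfy the conditions (i)–(iii) for j = k+1, and with the
constants (1+β)α₀, (1+β)α₁, α₀}. (3.16)»*

THE TYPING (carriers OF RECORD, nothing re-declared).  (a) Lattice: `Setup.Params/Site/PBond/Plaq`, the pairs `(𝐔, 𝐉)` =
`Setup.FieldPair P i 𝔸ˣ 𝔸` at an arbitrary lattice level `i` (`i = 0` is the finest torus, as in `Setup.RegularSpace`).  (b) Values: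
`𝔸` a complete normed `ℂ`-algebra (the matrix algebra `M_N(ℂ)` with the operator norm of [Balaban1985Averaging] (19)), exactly as in the
landed B12 §3 kernel files `B12Membership313II`/`B12Membership314`/`B12CondIIIJ`; `Gᶜ ⊂ 𝔸ˣ`, `G ⊂ Gᶜ` and `𝔤ᶜ ⊂ 𝔸` are the three
fields of `Model` (subgroups / a `ℂ`-submodule); `exp iξA` = `Beta.BackgroundVertices.expUnit ℂ ((iξ)•A)` (`expI`); the plaquette
variable `∂𝐔(p)` = `B8CurlGradHolonomy.plaqHol` on `Setup`'s plaquettes (`plaq`; it is `GaugeField.plaqHol` VERBATIM whenever the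
value group is a `Setup.GaugeGroup` — `plaq_eq_plaqHol` — which `𝔸ˣ = Gᶜ` is not: `dist1` there is conjugation-invariant, i.e.
models `G ⊂ U(N)` only); `∇^ξ_U` = `ξ⁻¹ ·` `B8CurlGradHolonomy.covD` with the adjoint transport `adT` (`nabla`, `nabla_eq_covD`;
`R(U)X = UXU⁻¹`, [Balaban1985BackgroundPropagators] (3.3)); `|·|` = the norm of `𝔸`, «on X» = at every plaquette / bond / derivative
pair of the region.  (c) GEOMETRY AS DATA (DIVERGENCE F5, as everywhere in the tree): a `Region` is the triple of index sets the
conditions quantify over (plaquettes `p ⊂ Y`, bonds `b ⊂ Y`, pairs `(x, μ, ν)` at which `(∇_μ A_ν)(x)` is taken on `Y`); a `Frame`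
for `X ∈ 𝐃_j` = the region `X`, the family of cubes `□ ⊂ X` «of a size O(1)LM» of (1.12), the region `X̃⁻²`, and the two families
of functions `𝐔 ↦ U_n(M˙(𝐔))`, `𝐔 ↦ J_n(M˙(𝐔))` of (1.15) (`BackgroundFns`: the averages `M˙` of (1.5) [14] composed with the
axial-gauge background fields `U_n` of [15] and with (1.8) — the constructions of B8/B11 that the tree carries as DATA, cf.
`Setup.Background`, `Step.SFTower.space`); `StepConsts` = `(j, ξ = L⁻ʲ, L, O(1)LMB)` (`StepConsts.ofParams` sets `ξ = Params.eta j`,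
`L = Params.L`).  (d) The four conditions are the `Prop`-valued structures `CondI` ((1.11)+(1.12), with the local-gauge clause as the
printed `∃ u ∃ A`), `CondII` (1.13), `CondIII` (1.14), `CondIV` (1.16) (stated for one configuration and imposed on `𝐔` AND on `U`);
`Satisfies` = «𝐔, 𝐉 satisfy (i)–(iv)» with the factorisation witnesses `U, A′` of `𝐔 = U′U`, `U′ = exp iξA′` existentially bound
(they are shared by (i), (ii), (iv)) and the value clauses `𝐔 ∈ Gᶜ`, `𝐉 ∈ 𝔤ᶜ` on `X`; `SatisfiesI_III` = the same without (iv)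
(p. 263 and (3.16)); `space` = `U^c_j(X, α₀, α₁, γ₀)` = the union of the `(1.10)`-orbits of `Satisfies` under `Gᶜ`-valued `u`;
`space'` = `U^c_j(X, α₀, α₁)` (`γ₀ = α₀`); `space316` = (3.16).  PROVED here: `act_one`/`act_mul` ((1.10) is an action),
`act_mem_space_iff` (gauge invariance «by the definition», p. 263), `space316_subset`; in the sibling `B12RegularSpaces111Mono`: the
monotonicity in the radii (p. 263) and the `Setup.CplxRegularSpace` structure these spaces form.  NOT here: the geometry of `𝐃_j`, of
the cubes and of `X̃⁻²` (data), the constructions `M˙`, `U_n`, `J_n` (data), Proposition 9 [15] / the membership remark (1.17) (row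
`B12.Eq1.17`, `B12Eq117Membership`), the last two sentences of p. 263's paragraph (`𝐉 = D^{ξ*}_𝐔 ξ⁻²π Im ∂𝐔`, minimal `U_j`).  No
`Prop` placeholder, no new fact; axioms standard.  Unit `lit-balaban-p07` (Phase-2 seat p07 gen 2; TAKING line HOME/STATUS.md
2026-08-21T02:45:59Z; DEFINITIONS steward gap A2), HOME `run/shared/lean/pub/lit-balaban/`.
-/

namespace Literature.MathematicalPhysics.QuantumFieldTheory.Balaban1983to89.B12RegularSpaces111

open Literature.MathematicalPhysics.QuantumFieldTheory.Balaban1983to89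
open Complex

noncomputable section

/-! ## §1. Geometry and background-field functions AS DATA; the constants of a step -/

/-- A region `Y` of the lattice (a localization domain `X ∈ 𝐃_j`, a cube `□ ⊂ X`, or `X̃⁻²`) seen through the three index sets
over which the conditions (1.11)–(1.16) quantify («on X», «on □», «on X̃⁻²»): the plaquettes `p ⊂ Y`, the bonds `b ⊂ Y`, and the
triples `(x, μ, ν)` at which a (covariant) derivative `(∇_μ A_ν)(x)` is taken on `Y`.  Geometry is data (DIVERGENCE F5).
[cite: Balaban1987RG1, (1.11)-(1.14) p.262] -/
structure Region (P : Params) (i : ℕ) where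
  /-- plaquettes `p ⊂ Y` -/
  plaqs : Set (Plaq P i)
  /-- (positively oriented) bonds `b ⊂ Y` -/
  bonds : Set (PBond P i)
  /-- derivative triples `(x, μ, ν)`: `(∇_μ A_ν)(x)` «on Y» -/
  dpairs : Set (Site P i × Fin P.d × Fin P.d)

/-- The functions of condition (iv), (1.15): `𝐔 ↦ U_n(M˙(𝐔))` and `𝐔 ↦ J_n(M˙(𝐔))`, `n = 1, …, j` — the multi-level averages
`M˙(𝐔, b) = Ū^p(b)`, `b ∈ Λ_p` ((1.5) [14]) composed with the axial-gauge background fields `U_n(V)` of [15] for the sequence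
`{Ω₀ = X, Ω₁, …, Ω_n}`, and with (1.8) («with U_n(M˙(𝐔)) instead of U_j, L⁻ⁿ instead of ξ»).  DATA (the constructions of
[14, 15] are carried by the tree as data: `Setup.Background`, `Setup.Averaging.iter`). [cite: Balaban1987RG1, (1.15) p.262] -/
structure BackgroundFns (P : Params) (i : ℕ) (𝔸 : Type*) [Monoid 𝔸] where
  /-- `𝐔 ↦ U_n(M˙(𝐔))` -/
  Un : ℕ → (PBond P i → 𝔸ˣ) → PBond P i → 𝔸ˣ
  /-- `𝐔 ↦ J_n(M˙(𝐔))` -/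
  Jn : ℕ → (PBond P i → 𝔸ˣ) → PBond P i → 𝔸

/-- Everything the definition of `U^c_j(X, α₀, α₁, γ₀)` uses about the localization domain `X ∈ 𝐃_j`: the region `X`, the family
of cubes `□ ⊂ X` «of a size O(1)LM» of (1.12), the region `X̃⁻²` («obtained from X by taking away two layers of cubes from π_j,
which are closest to the boundary of X»), and the functions (1.15) built from `X` «as Ω₀». [cite: Balaban1987RG1, (1.11)-(1.16) p.262] -/
structure Frame (P : Params) (i : ℕ) (𝔸 : Type*) [Monoid 𝔸] where
  /-- the localization domain `X` -/
  X : Region P i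
  /-- the cubes `□ ⊂ X` of size `O(1)LM` -/
  cubes : Set (Region P i)
  /-- `X̃⁻²` -/
  X₂ : Region P i
  /-- `U_n(M˙(·))`, `J_n(M˙(·))` -/
  bg : BackgroundFns P i 𝔸

/-- The value data: the compact group `G`, its complexification `Gᶜ` (both inside the unit group of the algebra `𝔸 ⊇ M_N(ℂ)`-like
values, «𝐔 … has values in Gᶜ», «U has values in the group G») and the complexified Lie algebra `𝔤ᶜ ⊂ 𝔸` («𝐉 … has values in 𝔤ᶜ»,
«A′ has values in the algebra 𝔤ᶜ»). [cite: Balaban1987RG1, (1.10) p.262] -/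
structure Model (𝔸 : Type*) [Ring 𝔸] [Algebra ℂ 𝔸] where
  /-- `G` -/
  G : Subgroup 𝔸ˣ
  /-- `Gᶜ` -/
  Gc : Subgroup 𝔸ˣ
  /-- `𝔤ᶜ` -/
  gc : Submodule ℂ 𝔸

/-- The constants of the `j`-th space: the number of steps `j` of (iv), `ξ = L⁻ʲ`, `L`, and the constant `O(1)LMB` of (1.12)
(«with a sufficiently large constant B (it will be determined later)»). [cite: Balaban1987RG1, (1.12) p.262] -/
structure StepConsts where
  /-- `j` -/
  j : ℕ
  /-- `ξ = L⁻ʲ` -/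
  ξ : ℝ
  /-- `L` -/
  L : ℝ
  /-- `O(1)LMB` -/
  cB : ℝ

/-- The constants of the `j`-th space over `Setup.Params`: `ξ = Params.eta j = L⁻ʲ`, `L = Params.L`.
[cite: Balaban1987RG1, (1.11) p.262] -/
def StepConsts.ofParams (P : Params) (cB : ℝ) (j : ℕ) : StepConsts where
  j := j
  ξ := P.eta j
  L := P.L
  cB := cB

/-! ## §2. Plaquette variables, the action (1.10), `exp iξA`, covariant derivatives -/

section Ops

variable {P : Params} {i : ℕ}

/-- The plaquette variable `∂U(p) = U(x, x+e_μ)U(x+e_μ, z)U(x+e_ν, z)⁻¹U(x, x+e_ν)⁻¹` of a configuration with values in ANY group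
(here `Gᶜ ⊂ 𝔸ˣ`): `B8CurlGradHolonomy.plaqHol` on the plaquettes of `Setup` (= `GaugeField.plaqHol`, `plaq_eq_plaqHol`).
[cite: Balaban1987RG1, (1.11) p.262] -/
def plaq {M : Type*} [Group M] (U : PBond P i → M) (p : Plaq P i) : M :=
  B8CurlGradHolonomy.plaqHol (fun x : Site P i => x.shift p.μ) (fun x : Site P i => x.shift p.ν)
    (fun x => U ⟨x, p.μ⟩) (fun x => U ⟨x, p.ν⟩) p.src

/-- The printed word of `∂U(p)`. [cite: Balaban1987RG1, (1.11) p.262] -/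
theorem plaq_eq {M : Type*} [Group M] (U : PBond P i → M) (p : Plaq P i) :
    plaq U p = U ⟨p.src, p.μ⟩ * U ⟨p.src.shift p.μ, p.ν⟩ * (U ⟨p.src.shift p.ν, p.μ⟩)⁻¹ * (U ⟨p.src, p.ν⟩)⁻¹ := rfl

/-- For a `Setup.GaugeGroup` (`G ⊂ U(N)`) the plaquette variable is `Setup`'s `GaugeField.plaqHol`, verbatim.
[cite: Balaban1987RG1, (1.11) p.262] -/
theorem plaq_eq_plaqHol {G : Type*} [GaugeGroup G] (U : GaugeField P i G) (p : Plaq P i) :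
    plaq U p = GaugeField.plaqHol U p :=
  rfl

variable {𝔸 : Type*} [Ring 𝔸]

/-- `𝐔^u(b) = u(b₋)𝐔(b)u(b₊)⁻¹` ((1.10), first component; [Balaban1985Averaging] (8)). [cite: Balaban1987RG1, (1.10) p.262] -/
def gaugeU (u : Site P i → 𝔸ˣ) (U : PBond P i → 𝔸ˣ) : PBond P i → 𝔸ˣ :=
  fun b => u b.src * U b * (u b.tgt)⁻¹

/-- `(R(u)𝐉)(b) = R(u₋)𝐉(b) = u(b₋)𝐉(b)u(b₋)⁻¹` ((1.10), second component; `R(U)X = UXU⁻¹`).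
[cite: Balaban1987RG1, (1.10) p.262] -/
def adJ (u : Site P i → 𝔸ˣ) (J : PBond P i → 𝔸) : PBond P i → 𝔸 :=
  fun b => (u b.src : 𝔸) * J b * ↑(u b.src)⁻¹

/-- **(1.10)**: the action of a `Gᶜ`-valued gauge transformation `u` on pairs, `(𝐔, 𝐉)^u = (𝐔^u, R(u)𝐉) = (u₋𝐔u₊⁻¹, R(u₋)𝐉)`.
[cite: Balaban1987RG1, (1.10) p.262] -/
def act (u : Site P i → 𝔸ˣ) (Φ : FieldPair P i 𝔸ˣ 𝔸) : FieldPair P i 𝔸ˣ 𝔸 where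
  U := gaugeU u Φ.U
  J := adJ u Φ.J

/-- Extensionality of pairs `(𝐔, 𝐉)`. [folklore] -/
private theorem fieldPair_ext {Φ Ψ : FieldPair P i 𝔸ˣ 𝔸} (hU : Φ.U = Ψ.U) (hJ : Φ.J = Ψ.J) : Φ = Ψ := by
  cases Φ; cases Ψ; cases hU; cases hJ; rfl

/-- (1.10) is an action: the identity transformation acts trivially. [cite: Balaban1987RG1, (1.10) p.262] -/
theorem act_one (Φ : FieldPair P i 𝔸ˣ 𝔸) : act (1 : Site P i → 𝔸ˣ) Φ = Φ := by
  refine fieldPair_ext ?_ ?_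
  · funext b
    show (1 : 𝔸ˣ) * Φ.U b * (1 : 𝔸ˣ)⁻¹ = Φ.U b
    rw [one_mul, inv_one, mul_one]
  · funext b
    show ((1 : 𝔸ˣ) : 𝔸) * Φ.J b * ↑(1 : 𝔸ˣ)⁻¹ = Φ.J b
    rw [inv_one, Units.val_one, one_mul, mul_one]

/-- (1.10) is an action: `(𝐔, 𝐉)^{vu} = ((𝐔, 𝐉)^u)^v` («the group of Gᶜ-valued gauge transformations»).
[cite: Balaban1987RG1, (1.10) p.262] -/
theorem act_mul (v u : Site P i → 𝔸ˣ) (Φ : FieldPair P i 𝔸ˣ 𝔸) : act (v * u) Φ = act v (act u Φ) := by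
  refine fieldPair_ext ?_ ?_
  · funext b
    show v b.src * u b.src * Φ.U b * (v b.tgt * u b.tgt)⁻¹ = v b.src * (u b.src * Φ.U b * (u b.tgt)⁻¹) * (v b.tgt)⁻¹
    rw [mul_inv_rev]
    simp only [mul_assoc]
  · funext b
    show ((v b.src * u b.src : 𝔸ˣ) : 𝔸) * Φ.J b * ↑(v b.src * u b.src)⁻¹ =
      (v b.src : 𝔸) * ((u b.src : 𝔸) * Φ.J b * ↑(u b.src)⁻¹) * ↑(v b.src)⁻¹
    rw [mul_inv_rev, Units.val_mul, Units.val_mul]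
    simp only [mul_assoc]

/-- `((𝐔, 𝐉)^u)^{u⁻¹} = (𝐔, 𝐉)`. [cite: Balaban1987RG1, (1.10) p.262] -/
theorem act_inv_act (u : Site P i → 𝔸ˣ) (Φ : FieldPair P i 𝔸ˣ 𝔸) : act u⁻¹ (act u Φ) = Φ := by
  rw [← act_mul, inv_mul_cancel, act_one]

variable [Algebra ℂ 𝔸]

/-- The covariant `ξ`-lattice derivative in the adjoint action of the background `U`:
`(∇^ξ_{U,μ}F)(x) = ξ⁻¹(R(U(x, x+ξe_μ))F(x+ξe_μ) − F(x))`, `R(U)X = UXU⁻¹` ([Balaban1985BackgroundPropagators] (3.3) in the `ξ`-scale).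
[cite: Balaban1987RG1, (1.13) p.262] -/
def nabla (ξ : ℝ) (U : PBond P i → 𝔸ˣ) (μ : Fin P.d) (F : Site P i → 𝔸) (x : Site P i) : 𝔸 :=
  (ξ : ℂ)⁻¹ • ((U ⟨x, μ⟩ : 𝔸) * F (x.shift μ) * ↑(U ⟨x, μ⟩)⁻¹ - F x)

/-- `∇^ξ_U` IS `ξ⁻¹ ·` the covariant difference `B8CurlGradHolonomy.covD` for the adjoint transporters `adT`.
[cite: Balaban1987RG1, (1.13) p.262] -/
theorem nabla_eq_covD (ξ : ℝ) (U : PBond P i → 𝔸ˣ) (μ : Fin P.d) (F : Site P i → 𝔸) (x : Site P i) :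
    nabla ξ U μ F x =
      (ξ : ℂ)⁻¹ • B8CurlGradHolonomy.covD (fun y : Site P i => y.shift μ)
        (B8CurlGradHolonomy.adT fun y : Site P i => U ⟨y, μ⟩) F x := by
  rw [B8CurlGradHolonomy.covD_adT_apply]
  rfl

/-- The plain `ξ`-lattice derivative `(∇^ξ_μ F)(x) = ξ⁻¹(F(x+ξe_μ) − F(x))` of (1.12) (`= ∇^ξ_U` at `U ≡ 1`, `nabla_one`).
[cite: Balaban1987RG1, (1.12) p.262] -/
def grad (ξ : ℝ) (μ : Fin P.d) (F : Site P i → 𝔸) (x : Site P i) : 𝔸 :=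
  (ξ : ℂ)⁻¹ • (F (x.shift μ) - F x)

/-- `∇^ξ_1 = ∇^ξ`. [cite: Balaban1987RG1, (1.12) p.262] -/
theorem nabla_one (ξ : ℝ) (μ : Fin P.d) (F : Site P i → 𝔸) (x : Site P i) :
    nabla ξ (1 : PBond P i → 𝔸ˣ) μ F x = grad ξ μ F x := by
  simp only [nabla, grad, Pi.one_apply, inv_one, Units.val_one, one_mul, mul_one]

end Ops

section Exp

variable {P : Params} {i : ℕ} {𝔸 : Type*} [NormedRing 𝔸] [NormedAlgebra ℂ 𝔸] [CompleteSpace 𝔸]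

/-- `exp iξA ∈ Gᶜ ⊂ 𝔸ˣ` as a unit of the algebra (value `exp(iξA)`, inverse `exp(−iξA)`: `Beta.BackgroundVertices.expUnit`, the
letter used by `B12Membership313II.condII_expMul`). [cite: Balaban1987RG1, (1.13) p.262] -/
def expI (ξ : ℝ) (a : 𝔸) : 𝔸ˣ :=
  Beta.BackgroundVertices.expUnit ℂ ((I * (ξ : ℂ)) • a)

end Exp

/-! ## §3. The four conditions (i)–(iv), (1.11)–(1.16) -/

section Conditions

variable {P : Params} {i : ℕ} {𝔸 : Type*} [NormedRing 𝔸] [NormedAlgebra ℂ 𝔸] [CompleteSpace 𝔸]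
variable (𝓜 : Model 𝔸)

/-- **Condition (i)** for the `G`-valued factor `U` of `𝐔 = U′U`: «U has values in the group G, |∂U − 1| < α₀ξ² on X, (1.11)
for each cube □ ⊂ X of a size O(1)LM there exists a G-valued gauge transformation u defined on □ and such, that U^u = exp iξA,
|A|, |∇^ξA| < O(1)LMBα₀ on □, (1.12)». [cite: Balaban1987RG1, (1.11)-(1.12) p.262] -/
structure CondI (F : Frame P i 𝔸) (c : StepConsts) (α₀ : ℝ) (U : PBond P i → 𝔸ˣ) : Prop where
  /-- «U has values in the group G» (on `X`) -/
  gValued : ∀ b ∈ F.X.bonds, U b ∈ 𝓜.G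
  /-- (1.11) `|∂U − 1| < α₀ξ²` on `X` -/
  plaq_lt : ∀ p ∈ F.X.plaqs, ‖(↑(plaq U p) : 𝔸) - 1‖ < α₀ * c.ξ ^ 2
  /-- (1.12): on every cube `□ ⊂ X` of size `O(1)LM` a `G`-valued `u` («defined on □»: its values off `□` are never used, so it
  is typed as an everywhere-defined `G`-valued `u`) with `U^u = exp iξA`, `|A|, |∇^ξA| < O(1)LMBα₀` on `□` -/
  localGauge : ∀ C ∈ F.cubes, ∃ u : Site P i → 𝔸ˣ, (∀ x, u x ∈ 𝓜.G) ∧ ∃ A : PBond P i → 𝔸,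
    (∀ b ∈ C.bonds, gaugeU u U b = expI c.ξ (A b)) ∧ (∀ b ∈ C.bonds, ‖A b‖ < c.cB * α₀) ∧
      ∀ q ∈ C.dpairs, ‖grad c.ξ q.2.1 (fun y => A ⟨y, q.2.2⟩) q.1‖ < c.cB * α₀

/-- **Condition (ii)** for the algebra-valued `A′` of `U′ = exp iξA′` (covariant derivative in the background `U` of (i)):
«A′ has values in the algebra 𝔤ᶜ, |A′|, |∇^ξ_U A′| < α₁ on X. (1.13)». [cite: Balaban1987RG1, (1.13) p.262] -/
structure CondII (X : Region P i) (c : StepConsts) (α₁ : ℝ) (U : PBond P i → 𝔸ˣ) (A' : PBond P i → 𝔸) : Prop where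
  /-- «A′ has values in the algebra 𝔤ᶜ» (on `X`) -/
  gcValued : ∀ b ∈ X.bonds, A' b ∈ 𝓜.gc
  /-- `|A′| < α₁` on `X` -/
  norm_lt : ∀ b ∈ X.bonds, ‖A' b‖ < α₁
  /-- `|∇^ξ_U A′| < α₁` on `X` -/
  nabla_lt : ∀ q ∈ X.dpairs, ‖nabla c.ξ U q.2.1 (fun y => A' ⟨y, q.2.2⟩) q.1‖ < α₁

/-- **Condition (iii)**: «The configurations 𝐔, 𝐉 satisfy the bounds |∂𝐔 − 1| < α₀ξ², |𝐉| < γ₀ on X. (1.14)».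
[cite: Balaban1987RG1, (1.14) p.262] -/
structure CondIII (X : Region P i) (c : StepConsts) (α₀ γ₀ : ℝ) (Uc : PBond P i → 𝔸ˣ) (Jc : PBond P i → 𝔸) :
    Prop where
  /-- `|∂𝐔 − 1| < α₀ξ²` on `X` -/
  plaq_lt : ∀ p ∈ X.plaqs, ‖(↑(plaq Uc p) : 𝔸) - 1‖ < α₀ * c.ξ ^ 2
  /-- `|𝐉| < γ₀` on `X` -/
  J_lt : ∀ b ∈ X.bonds, ‖Jc b‖ < γ₀

/-- **Condition (iv)** for one configuration `V` (the print imposes it on `𝐔` «and the same bounds hold for U instead of 𝐔»):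
«|∂U_n(M˙(V)) − 1| < α₀ξ², |J_n(M˙(V))| < α₀(Lⁿξ)² on X̃⁻², (1.16)», `n = 1, …, j`. [cite: Balaban1987RG1, (1.15)-(1.16) p.262] -/
structure CondIV (bg : BackgroundFns P i 𝔸) (X₂ : Region P i) (c : StepConsts) (α₀ : ℝ) (V : PBond P i → 𝔸ˣ) :
    Prop where
  /-- `|∂U_n(M˙(V)) − 1| < α₀ξ²` on `X̃⁻²`, `1 ≤ n ≤ j` -/
  plaq_lt : ∀ n, 1 ≤ n → n ≤ c.j → ∀ p ∈ X₂.plaqs, ‖(↑(plaq (bg.Un n V) p) : 𝔸) - 1‖ < α₀ * c.ξ ^ 2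
  /-- `|J_n(M˙(V))| < α₀(Lⁿξ)²` on `X̃⁻²`, `1 ≤ n ≤ j` -/
  J_lt : ∀ n, 1 ≤ n → n ≤ c.j → ∀ b ∈ X₂.bonds, ‖bg.Jn n V b‖ < α₀ * (c.L ^ n * c.ξ) ^ 2

/-- The factorisation of (i)/(ii): «𝐔 = U′U», «U′ = exp iξA′» (bondwise product, [Balaban1985BackgroundPropagators] (3.1)).
[cite: Balaban1987RG1, (1.11) p.262] -/
def Factors (c : StepConsts) (Uc U : PBond P i → 𝔸ˣ) (A' : PBond P i → 𝔸) : Prop :=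
  ∀ b, Uc b = expI c.ξ (A' b) * U b

/-- «𝐔, 𝐉 satisfy the conditions (i)–(iii)» with constants `α₀, α₁, γ₀` (the set of p. 263 and of (3.16)): `𝐔` is `Gᶜ`-valued and
`𝐉` is `𝔤ᶜ`-valued on `X`, and for some factorisation `𝐔 = (exp iξA′)U` conditions (i), (ii), (iii) hold.
[cite: Balaban1987RG1, (1.11)-(1.14) p.262] -/
def SatisfiesI_III (F : Frame P i 𝔸) (c : StepConsts) (α₀ α₁ γ₀ : ℝ) (Φ : FieldPair P i 𝔸ˣ 𝔸) : Prop :=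
  (∀ b ∈ F.X.bonds, Φ.U b ∈ 𝓜.Gc) ∧ (∀ b ∈ F.X.bonds, Φ.J b ∈ 𝓜.gc) ∧
    ∃ (U : PBond P i → 𝔸ˣ) (A' : PBond P i → 𝔸), Factors c Φ.U U A' ∧
      CondI 𝓜 F c α₀ U ∧ CondII 𝓜 F.X c α₁ U A' ∧ CondIII F.X c α₀ γ₀ Φ.U Φ.J

/-- «configurations 𝐔, 𝐉 satisfying the four conditions» (i)–(iv) with constants `α₀, α₁, γ₀` — (iv) for `𝐔` and for the factor `U`.
[cite: Balaban1987RG1, (1.11)-(1.16) p.262] -/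
def Satisfies (F : Frame P i 𝔸) (c : StepConsts) (α₀ α₁ γ₀ : ℝ) (Φ : FieldPair P i 𝔸ˣ 𝔸) : Prop :=
  (∀ b ∈ F.X.bonds, Φ.U b ∈ 𝓜.Gc) ∧ (∀ b ∈ F.X.bonds, Φ.J b ∈ 𝓜.gc) ∧
    ∃ (U : PBond P i → 𝔸ˣ) (A' : PBond P i → 𝔸), Factors c Φ.U U A' ∧
      CondI 𝓜 F c α₀ U ∧ CondII 𝓜 F.X c α₁ U A' ∧ CondIII F.X c α₀ γ₀ Φ.U Φ.J ∧
        CondIV F.bg F.X₂ c α₀ Φ.U ∧ CondIV F.bg F.X₂ c α₀ U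

/-- (i)–(iv) ⇒ (i)–(iii). [cite: Balaban1987RG1, (1.11)-(1.16) p.262] -/
theorem Satisfies.toI_III {F : Frame P i 𝔸} {c : StepConsts} {α₀ α₁ γ₀ : ℝ} {Φ : FieldPair P i 𝔸ˣ 𝔸}
    (h : Satisfies 𝓜 F c α₀ α₁ γ₀ Φ) : SatisfiesI_III 𝓜 F c α₀ α₁ γ₀ Φ := by
  obtain ⟨hG, hg, U, A', hf, h1, h2, h3, -, -⟩ := h
  exact ⟨hG, hg, U, A', hf, h1, h2, h3⟩

/-! ## §4. The spaces: `U^c_j(X, α₀, α₁, γ₀)` as the union of orbits, `γ₀ = α₀`, and (3.16) -/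

/-- **The space `U^c_j(X, α₀, α₁, γ₀)`**: «a union of orbits [(𝐔, 𝐉)] determined by configurations 𝐔, 𝐉 satisfying the four
conditions» — the pairs `(𝐔, 𝐉)^u`, `u` a `Gᶜ`-valued gauge transformation, `(𝐔, 𝐉)` satisfying (i)–(iv).
[cite: Balaban1987RG1, (1.11)-(1.16) p.262] -/
def space (F : Frame P i 𝔸) (c : StepConsts) (α₀ α₁ γ₀ : ℝ) : Set (FieldPair P i 𝔸ˣ 𝔸) :=
  {Φ | ∃ (u : Site P i → 𝔸ˣ) (Φ₀ : FieldPair P i 𝔸ˣ 𝔸),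
    (∀ x, u x ∈ 𝓜.Gc) ∧ Satisfies 𝓜 F c α₀ α₁ γ₀ Φ₀ ∧ Φ = act u Φ₀}

/-- **`U^c_j(X, α₀, α₁)`**: «Usually we consider spaces with γ₀ = α₀, and then we omit the constant γ₀ from the symbol denoting
the space.» [cite: Balaban1987RG1, (1.16) p.263] -/
abbrev space' (F : Frame P i 𝔸) (c : StepConsts) (α₀ α₁ : ℝ) : Set (FieldPair P i 𝔸ˣ 𝔸) :=
  space 𝓜 F c α₀ α₁ α₀

/-- **(3.16)**: «U^c_j(X, ½α₀, ½α₁, α₀) ∩ {(𝐔, 𝐉): 𝐔, 𝐉 satisfy the conditions (i)–(iii) for j = k+1, and with the constants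
(1+β)α₀, (1+β)α₁, α₀}» — the domain of the analytic extension (3.15); `Fj, cj` = the frame/constants of `X` at scale `j`, `Fk, ck`
those of the same `X` read at scale `k+1` (its cubes of (1.12) and `ξ = L^{−(k+1)}`). [cite: Balaban1987RG1, (3.16) p.273] -/
def space316 (Fj : Frame P i 𝔸) (cj : StepConsts) (Fk : Frame P i 𝔸) (ck : StepConsts) (β α₀ α₁ : ℝ) :
    Set (FieldPair P i 𝔸ˣ 𝔸) :=
  space 𝓜 Fj cj (α₀ / 2) (α₁ / 2) α₀ ∩ {Φ | SatisfiesI_III 𝓜 Fk ck ((1 + β) * α₀) ((1 + β) * α₁) α₀ Φ}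

variable {𝓜}

/-- A pair satisfying (i)–(iv) lies in the space (its own orbit, `u = 1`). [cite: Balaban1987RG1, (1.11)-(1.16) p.262] -/
theorem mem_space_of_satisfies {F : Frame P i 𝔸} {c : StepConsts} {α₀ α₁ γ₀ : ℝ} {Φ : FieldPair P i 𝔸ˣ 𝔸}
    (h : Satisfies 𝓜 F c α₀ α₁ γ₀ Φ) : Φ ∈ space 𝓜 F c α₀ α₁ γ₀ :=
  ⟨1, Φ, fun _ => 𝓜.Gc.one_mem, h, (act_one Φ).symm⟩

/-- **Gauge invariance of the spaces, forward**: `(𝐔, 𝐉) ∈ U^c_j ⇒ (𝐔, 𝐉)^v ∈ U^c_j` for `Gᶜ`-valued `v` («The spaces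
U^c_j(X, α₀, α₁) are, by the definition, gauge invariant»). [cite: Balaban1987RG1, (1.19) p.263] -/
theorem act_mem_space {F : Frame P i 𝔸} {c : StepConsts} {α₀ α₁ γ₀ : ℝ} {Φ : FieldPair P i 𝔸ˣ 𝔸}
    (hΦ : Φ ∈ space 𝓜 F c α₀ α₁ γ₀) {v : Site P i → 𝔸ˣ} (hv : ∀ x, v x ∈ 𝓜.Gc) :
    act v Φ ∈ space 𝓜 F c α₀ α₁ γ₀ := by
  obtain ⟨u, Φ₀, hu, h₀, rfl⟩ := hΦ
  exact ⟨v * u, Φ₀, fun x => 𝓜.Gc.mul_mem (hv x) (hu x), h₀, (act_mul v u Φ₀).symm⟩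

/-- **Gauge invariance of the spaces** («by the definition», p. 263): for a `Gᶜ`-valued gauge transformation `v`,
`(𝐔, 𝐉)^v ∈ U^c_j(X, α₀, α₁, γ₀) ↔ (𝐔, 𝐉) ∈ U^c_j(X, α₀, α₁, γ₀)`. [cite: Balaban1987RG1, (1.19) p.263] -/
theorem act_mem_space_iff {F : Frame P i 𝔸} {c : StepConsts} {α₀ α₁ γ₀ : ℝ} (Φ : FieldPair P i 𝔸ˣ 𝔸)
    {v : Site P i → 𝔸ˣ} (hv : ∀ x, v x ∈ 𝓜.Gc) :
    act v Φ ∈ space 𝓜 F c α₀ α₁ γ₀ ↔ Φ ∈ space 𝓜 F c α₀ α₁ γ₀ := by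
  refine ⟨fun h => ?_, fun h => act_mem_space h hv⟩
  have hv' : ∀ x, v⁻¹ x ∈ 𝓜.Gc := fun x => by
    rw [Pi.inv_apply]
    exact 𝓜.Gc.inv_mem (hv x)
  simpa only [act_inv_act] using act_mem_space h hv'

/-! ## §5. (3.16): the printed inclusion -/

/-- (3.16) is contained in `U^c_j(X, ½α₀, ½α₁, α₀)`. [cite: Balaban1987RG1, (3.16) p.273] -/
theorem space316_subset (Fj : Frame P i 𝔸) (cj : StepConsts) (Fk : Frame P i 𝔸) (ck : StepConsts) (β α₀ α₁ : ℝ) :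
    space316 𝓜 Fj cj Fk ck β α₀ α₁ ⊆ space 𝓜 Fj cj (α₀ / 2) (α₁ / 2) α₀ :=
  Set.inter_subset_left

end Conditions

end

end Literature.MathematicalPhysics.QuantumFieldTheory.Balaban1983to89.B12RegularSpaces111
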